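import Summits.ABC.StewartYu.PadicG3TwoSatPack
import Summits.ABC.StewartYu.PadicG3TwoFrameSatDet
import Summits.ABC.StewartYu.PadicG3TwoNegBoundSat
import Summits.ABC.StewartYu.PadicG3TwoParTwo
import HarnessLib

/-!
# Cell abc-stewartyu, WP-L.P(2) (crux r4 `PadicCoreTwoRat`, stmt-ABC-20504), record interface: the THREE SUPPLIES of the 𝔑-threaded
# `2`-adic frame (gain pack, smallness pack, END) and the per-datum assembly **`recordSupplyTwoSatDet_of_supplies`**

`Summits/ABC/StewartYu/PadicG3TwoSatSupply.lean` — cell `abc-stewartyu` (HOME `run/shared/lean/pub/abc-stewartyu/`), route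
`YuMatveevShapeRat`, seat p3 (g10, WP-L.P(2) lead; design line STATUS 2026-08-27T18:43Z + correction 19:02Z).  Three `Prop` definitions
(the texts of the re-cut stubs of line `padic-two-sat-frame`) and one theorem; no named fact.  Twin of p5's `PadicG3TwoDatumPackage` /
p2's `recordSupplyAtSatR_of_pack`.

THE RECORD IS THE LANDED ONE: for the crux datum `(V, Vmax, W)` the schedule of record is `schedTwoN S F P` at p3-g6's
`P := ParTwo.parTwo V Vmax W` (crux `W`, NOT a `W̃`: every `N`-cost of type `T₀·log N`, `|t|·log|b̃|` is absorbed by the `T₀·W_L` slack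
since `log N ≤ log L`; and the END then is the landed `ParTwo.recordTwo_parTwo` at the crux `W`).  What a supply may use about the set-up
`S` and its saturation datum `F` is ONLY the size data: `h(αoⱼ) ≤ 2Vⱼ` (`αo = α²`), `h(ϑₖ) ≤ 2ΣVⱼ`, `|b̃ₖ| ≤ (d+1)·(d+1)!·N·e^W`,
`N ≤ (2/log 2)^{d+1}·∏Vⱼ`, `Ucol j ≤ (d+1)·N` (and `Σₖ|Uₖⱼ| ≤ Ucol j`).

* `GainSupplyTwoN` — ∀ set-up/saturation datum/`(V, Vmax, W)`/`Ucol` with the size data: `GainPackTwoN S F (parTwo V Vmax W) Ucol`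
  (the record's arithmetic: sizes + budgets; stub `stub_gainTwoN`);
* `SmallSupplyTwoN C` — same data plus a natural `U` with `C(d+1)·∏V·(W + log 2Vmax) < U + 1` and the smallness
  `‖Λ₀‖ ≤ |b̃_θ|·2^{−U}` (what `PadicG3TwoNegBoundSat.norm_Λ₀_ofData_sat_le` extracts from the negated bound): `SmallPackTwoN …`
  (the headline; stub `stub_smallTwoN`);
* `EndSupplyTwoN C` — same data: the END ranges of `schedTwoN` against the dyadic END data and `RecordTwo C (d+1) V Vmax W …` (stub
  `stub_endTwoN`; = p5's (C1)–(C4) twin + the landed `recordTwo_parTwo`);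
* **`recordSupplyTwoSatDet_of_supplies`** — `GainSupplyTwoN → SmallSupplyTwoN C → EndSupplyTwoN C → (∀ r, 0 ≤ C r) → ∀ d ≥ 1,
  RecordSupplyTwoSatDet C d`: per datum, the size data from the presentation's hypotheses, `U := ⌊C(d+1)∏V(W + log 2Vmax)⌋₊` and the
  smallness from the negated bound, then `frameNumericsTwoRASat_schedTwoN`.

WHAT THIS IS NOT: the three supplies themselves (stubs); no crux moves (A1.L not moved).

References: Yu. V. Nesterenko, LNM 1819 (2003), §3.5, §4, §5.2; K. Yu, Acta Math. 211 (2013), §3.1, §5–§6; HOME/p3/memo-12.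
-/

noncomputable section

open Finset Polynomial
open scoped Matrix Nat
open Literature.NumberTheory.Transcendental
open Literature.NumberTheory.Transcendental (FeldmanDelta.den)
open Literature.NumberTheory.Transcendental.CW77 (heightProd)
open Literature.NumberTheory.Transcendental.CW77.Setup (Tau tauNorm)
open Literature.NumberTheory.Transcendental.PadicCW77 (condExp)

namespace Summit.ABC.StewartYu

namespace TwoSetup

open Summit.ABC.StewartYu.G3Boxes

/-! ### The three supplies -/

/-- **THE GAIN SUPPLY** (the record's arithmetic): for every `2`-adic set-up `S` with a saturation datum `F`, weights `1 ≤ Vⱼ ≤ Vmax`,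
`W ≥ 1`, a basis slot `Ucol`, under the size data of the saturated presentation, the gain pack of the schedule of record at the landed
record `ParTwo.parTwo V Vmax W`. [cite: Nesterenko2003, Prop 3.9, §4 (4.20)–(4.35)] [cite: Yu2013, Lemma 5.2, Lemma 5.4; shape only] -/
def GainSupplyTwoN : Prop :=
  ∀ (S : TwoSetup) (F : S.SatData) (V : Fin (S.d + 1) → ℝ) (Vmax W : ℝ) (Ucol : Fin (S.d + 1) → ℕ),
    1 ≤ S.d → ∀ (hV1 : ∀ j, 1 ≤ V j) (hVmax : ∀ j, V j ≤ Vmax) (hW1 : 1 ≤ W),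
    (∀ j, Height.logHeight₁ (F.αo j) ≤ 2 * V j) →
    (∀ k, Height.logHeight₁ (S.toQ.all k) ≤ 2 * ∑ j, V j) →
    (∀ k, (|S.ball k| : ℝ) ≤ (((S.d + 1) * (S.d + 1)! : ℕ) : ℝ) * F.N * Real.exp W) →
    (F.N : ℝ) ≤ (2 / Real.log 2) ^ (S.d + 1) * ∏ j, V j →
    (∀ j, Ucol j ≤ (S.d + 1) * F.N) →
    S.GainPackTwoN F (ParTwo.parTwo V Vmax W hV1 hVmax hW1) Ucol

/-- **THE SMALLNESS SUPPLY** (the headline): under the same size data, a natural `U` above `C(d+1)·∏V·(W + log 2Vmax) − 1` and the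
smallness `‖Λ₀‖ ≤ |b̃_θ|·2^{−U}` give the smallness pack of the schedule of record. [cite: Yu2013, Lemma 5.1–5.2 (5.19), (5.29); shape only] -/
def SmallSupplyTwoN (C : ℕ → ℝ) : Prop :=
  ∀ (S : TwoSetup) (F : S.SatData) (V : Fin (S.d + 1) → ℝ) (Vmax W : ℝ) (Ucol : Fin (S.d + 1) → ℕ),
    1 ≤ S.d → ∀ (hV1 : ∀ j, 1 ≤ V j) (hVmax : ∀ j, V j ≤ Vmax) (hW1 : 1 ≤ W),
    (∀ j, Height.logHeight₁ (F.αo j) ≤ 2 * V j) →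
    (∀ k, Height.logHeight₁ (S.toQ.all k) ≤ 2 * ∑ j, V j) →
    (∀ k, (|S.ball k| : ℝ) ≤ (((S.d + 1) * (S.d + 1)! : ℕ) : ℝ) * F.N * Real.exp W) →
    (F.N : ℝ) ≤ (2 / Real.log 2) ^ (S.d + 1) * ∏ j, V j →
    (∀ j, Ucol j ≤ (S.d + 1) * F.N) →
    ∀ U : ℕ, C (S.d + 1) * (∏ j, V j) * (W + Real.log (2 * Vmax)) < U + 1 →
    ‖S.Λ₀‖ ≤ |(S.bθ : ℝ)| * (2 : ℝ) ^ (-(U : ℤ)) →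
    S.SmallPackTwoN F (ParTwo.parTwo V Vmax W hV1 hVmax hW1) Ucol

/-- **THE END SUPPLY**: under the same weights, the END ranges of the schedule of record dominate END data `(D₀', S₀, X, D')` for which
`RecordTwo C (d+1) V Vmax W D₀' S₀ X D'` holds. [cite: Nesterenko2003, §5.2 (5.13)–(5.22); shape only] -/
def EndSupplyTwoN (C : ℕ → ℝ) : Prop :=
  ∀ (S : TwoSetup) (F : S.SatData) (V : Fin (S.d + 1) → ℝ) (Vmax W : ℝ),
    1 ≤ S.d → ∀ (hV1 : ∀ j, 1 ≤ V j) (hVmax : ∀ j, V j ≤ Vmax) (hW1 : 1 ≤ W),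
    (F.N : ℝ) ≤ (2 / Real.log 2) ^ (S.d + 1) * ∏ j, V j →
    ∃ (S₀ X D₀' : ℕ) (D' : Fin (S.d + 1) → ℕ),
      (S.d + 1 + 1) * X ≤ (S.schedTwoN F (ParTwo.parTwo V Vmax W hV1 hVmax hW1)).Nfin
          (S.schedTwoN F (ParTwo.parTwo V Vmax W hV1 hVmax hW1)).Istar ∧
      (S.d + 1 + 1) * S₀ < (S.schedTwoN F (ParTwo.parTwo V Vmax W hV1 hVmax hW1)).Tfin
          (S.schedTwoN F (ParTwo.parTwo V Vmax W hV1 hVmax hW1)).Istar ∧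
      (S.schedTwoN F (ParTwo.parTwo V Vmax W hV1 hVmax hW1)).D₀ ≤ D₀' ∧
      (∀ j, S.Bv3N F (ParTwo.parTwo V Vmax W hV1 hVmax hW1)
          (S.schedTwoN F (ParTwo.parTwo V Vmax W hV1 hVmax hW1)).Istar j ≤ D' j) ∧
      GenThreeFrameSpecTwo.RecordTwo C (S.d + 1) V Vmax W D₀' S₀ X D'

/-! ### The per-datum assembly -/

/-- `log (max 3 |b|) ≤ W ⇒ |b| ≤ e^W` (local copy of the helper in `PadicG3TwoClose`). [folklore] -/
private theorem abs_le_exp_of_log_max_le' {b : ℤ} {W : ℝ} (h : Real.log (max 3 (|b| : ℝ)) ≤ W) : (|b| : ℝ) ≤ Real.exp W := by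
  have h3 : (0 : ℝ) < max 3 (|b| : ℝ) := lt_of_lt_of_le (by norm_num) (le_max_left _ _)
  have := Real.exp_le_exp.mpr h
  rw [Real.exp_log h3] at this
  exact (le_max_right _ _).trans this

/-- **THE RECORD'S SUPPLY (index identity available) FROM THE THREE SUPPLIES.**  Per crux datum and pivot-last saturated presentation:
the size data (`h(α²) = 2h(α) ≤ 2V`, `h(ϑ) ≤ 2Σmax(1,h(α)) ≤ 2ΣV`, `|b̃ₖ| = |Σ bⱼ Cⱼₖ| ≤ (d+1)·(d+1)!·N·e^W`, `N ≤ ∏ 2max(1,h)/log 2 ≤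
(2/log 2)^{d+1}∏V`), the smallness `‖Λ₀‖ ≤ |b̃_θ|·2^{−U}` at `U = ⌊C(d+1)∏V(W + log 2Vmax)⌋₊` from the negated bound
(`norm_Λ₀_ofData_sat_le`), then `frameNumericsTwoRASat_schedTwoN`. [cite: Yu2013, §3.1, §6; shape only] [cite: Nesterenko2003, §5] -/
theorem recordSupplyTwoSatDet_of_supplies {C : ℕ → ℝ} (hC0 : ∀ r, 0 ≤ C r) (hG : GainSupplyTwoN) (hΛ : SmallSupplyTwoN C)
    (hE : EndSupplyTwoN C) {d : ℕ} (hd : 1 ≤ d) : RecordSupplyTwoSatDet C d := by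
  intro α b V Vmax W hα hind hV hV1 hVmax hb hW hW1 hneg ϑ Cm U N Ucol hϑ hlast hmin hpos hN hU hα2 hϑind hαo hUC hCU hdet
    hNle hUcol1 hUcol2 hCbnd hhϑ
  -- the set-up, its saturation datum, the record
  set S : TwoSetup := ofData d ϑ (b ᵥ* Cm) hϑ hlast hmin with hSdef
  set F : S.SatData := satDataOf d ϑ (b ᵥ* Cm) hϑ hlast hmin (fun j => α j ^ 2) hα2 hpos U N hN hU with hFdef
  set P : PadicG3Par (S.d + 1) := ParTwo.parTwo V Vmax W hV1 hVmax hW1 with hPdef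
  -- the size data
  have hmaxV : ∀ j, max 1 (Height.logHeight₁ (α j)) ≤ V j := fun j => max_le (hV1 j) (hV j)
  have hs1 : ∀ j, Height.logHeight₁ (F.αo j) ≤ 2 * V j := by
    intro j
    change Height.logHeight₁ (α j ^ 2) ≤ 2 * V j
    rw [Height.logHeight₁_pow]; push_cast
    linarith [hV j]
  have hs2 : ∀ k, Height.logHeight₁ (S.toQ.all k) ≤ 2 * ∑ j, V j := by
    intro k
    have hk : S.toQ.all k = ϑ k := congrFun (ofData_all ϑ (b ᵥ* Cm) hϑ hlast hmin) k
    rw [hk]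
    refine (hhϑ k).trans ?_
    exact mul_le_mul_of_nonneg_left (Finset.sum_le_sum fun j _ => hmaxV j) (by norm_num)
  have hbW : ∀ j, (|b j| : ℝ) ≤ Real.exp W := fun j => abs_le_exp_of_log_max_le' (hW j)
  have hs3 : ∀ k, (|S.ball k| : ℝ) ≤ (((S.d + 1) * (S.d + 1)! : ℕ) : ℝ) * F.N * Real.exp W := by
    intro k
    have hk : S.ball k = (b ᵥ* Cm) k := congrFun (ofData_ball ϑ (b ᵥ* Cm) hϑ hlast hmin) k
    rw [hk]
    change (|(((b ᵥ* Cm) k : ℤ) : ℝ)|) ≤ (((d + 1) * (d + 1)! : ℕ) : ℝ) * (N : ℝ) * Real.exp W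
    have h1 : |(b ᵥ* Cm) k| ≤ ∑ j, |b j| * ((((d + 1)! : ℕ) : ℤ) * N) := by
      simp only [Matrix.vecMul, dotProduct]
      refine (abs_sum_le_sum_abs _ _).trans (Finset.sum_le_sum fun j _ => ?_)
      rw [abs_mul]
      exact mul_le_mul_of_nonneg_left (hCbnd j k) (abs_nonneg _)
    have h2 : (|(b ᵥ* Cm) k| : ℝ) ≤ ∑ j, (|b j| : ℝ) * ((((d + 1)! : ℕ) : ℝ) * N) := by exact_mod_cast h1
    refine h2.trans ?_
    calc ∑ j, (|b j| : ℝ) * ((((d + 1)! : ℕ) : ℝ) * N)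
        ≤ ∑ _j : Fin (d + 1), Real.exp W * ((((d + 1)! : ℕ) : ℝ) * N) :=
          Finset.sum_le_sum fun j _ => mul_le_mul_of_nonneg_right (hbW j) (by positivity)
      _ = (((d + 1) * (d + 1)! : ℕ) : ℝ) * (N : ℝ) * Real.exp W := by
          rw [Finset.sum_const, Finset.card_univ, Fintype.card_fin]; push_cast; ring
  have hs4 : (F.N : ℝ) ≤ (2 / Real.log 2) ^ (S.d + 1) * ∏ j, V j := by
    change (N : ℝ) ≤ (2 / Real.log 2) ^ (d + 1) * ∏ j, V j
    have hl : 0 < Real.log 2 := Real.log_pos one_lt_two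
    have e : ∏ j : Fin (d + 1), (2 * V j / Real.log 2) = (2 / Real.log 2) ^ (d + 1) * ∏ j, V j := by
      rw [show (fun j : Fin (d + 1) => 2 * V j / Real.log 2) = fun j => (2 / Real.log 2) * V j from
        funext fun j => by ring, Finset.prod_mul_distrib, Finset.prod_const, Finset.card_univ, Fintype.card_fin]
    rw [← e]
    refine hNle.trans (Finset.prod_le_prod (fun j _ => by have := hmaxV j; positivity) fun j _ => ?_)
    exact div_le_div_of_nonneg_right (by linarith [hmaxV j]) hl.le
  have hs5 : ∀ j, Ucol j ≤ (S.d + 1) * F.N := by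
    intro j
    have := hUcol2 j
    change Ucol j ≤ (d + 1) * N
    exact_mod_cast this
  have hdS : 1 ≤ S.d := hd
  -- the smallness from the negated bound
  set T : ℝ := C (d + 1) * (∏ j, V j) * (W + Real.log (2 * Vmax)) with hTdef
  have hT0 : 0 ≤ T := by
    have h1 : 0 ≤ ∏ j, V j := Finset.prod_nonneg fun j _ => by linarith [hV1 j]
    have hVmax1 : 1 ≤ Vmax := (hV1 0).trans (hVmax 0)
    have h2 : 0 ≤ W + Real.log (2 * Vmax) := by
      have := Real.log_nonneg (by linarith : (1 : ℝ) ≤ 2 * Vmax); linarith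
    exact mul_nonneg (mul_nonneg (hC0 _) h1) h2
  set Uₙ : ℕ := ⌊T⌋₊ with hUdef
  have hUT : (Uₙ : ℝ) ≤ T := Nat.floor_le hT0
  have hTU : T < Uₙ + 1 := Nat.lt_floor_add_one T
  have hsmall : ‖S.Λ₀‖ ≤ |(S.bθ : ℝ)| * (2 : ℝ) ^ (-(Uₙ : ℤ)) := by
    change ‖(ofData d ϑ (b ᵥ* Cm) hϑ hlast hmin).Λ₀‖ ≤ |(((b ᵥ* Cm) (Fin.last d) : ℤ) : ℝ)| * (2 : ℝ) ^ (-(Uₙ : ℤ))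
    have h := norm_Λ₀_ofData_sat_le α ϑ hα hind b hb hϑ hϑind Cm hαo hlast hmin hneg hUT
    simpa using h
  -- the three supplies at this datum
  have hGp : S.GainPackTwoN F P Ucol := hG S F V Vmax W Ucol hdS hV1 hVmax hW1 hs1 hs2 hs3 hs4 hs5
  have hΛp : S.SmallPackTwoN F P Ucol := hΛ S F V Vmax W Ucol hdS hV1 hVmax hW1 hs1 hs2 hs3 hs4 hs5 Uₙ hTU hsmall
  obtain ⟨S₀, X, D₀', D', hX, hTf, hD₀, hD, hrec⟩ := hE S F V Vmax W hdS hV1 hVmax hW1 hs4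
  -- the obligation list
  have hnum := frameNumericsTwoRASat_schedTwoN (S := S) (F := F) (P := P) (Ucol := Ucol) Cm hCU hdet hCbnd hUcol1 hGp hΛp
  exact ⟨S.schedTwoN F P, S.Bv3N F P, S.Bv3N F P 0, P.H, S.L03N F P, S.famSatN F P, S₀, X, D₀', D', hnum, hΛp.slab, hX, hTf,
    hD₀, hD, hrec⟩

end TwoSetup

end Summit.ABC.StewartYu

end
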